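import Summits.QuantumFields.YangMills.Theorems.DiagonalMirrorRPROddLogGap

/-!
# Crux `WeakCouplingHypercubicLimitRP` (stmt-QuantumFields-27395 / twin 27398), door B: the ONE-LETTER cold package
# `DiagCold ⇒ OddLogGap ∧ DiagLukewarm ⇒ OddTorusSwapPairingLiminf` (crux-ideate g9/k1 addendum sketch; no new door)

Seat `cruxidea-stmt-QuantumFields-27395-1` g9 (k = 1).  Ideation bookkeeping only: a kernel-checked ADAPTER showing that the landed
door-B core `core_of_logGap` (✓ `…DiagonalMirrorRPROddLogGap`) consumes no odd-sector information beyond what a super-logarithmically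
COLD normalised even heat trace of the diagonal slice model already contains.  `DiagCold 𝔪` (below) is the diagonal-slicing twin of
door D's `CubeQuarterCold` (card `Ideas/axis-cold-parity-bridge.md`) typed on door B's interface: for some aspect `0 < θ < 1/2` and a
super-logarithmic `M_k` (`M_k / log side_k → ∞`), eventually `Tr (|A_k|/λ₀(k))^{2t} ≤ 1 + e^{-M_k}` for all `t ≥ θ·side_k`.

* `diagLukewarm_of_diagCold` — R2 with `C = 2`;
* `oddLogGap_of_diagCold` — R1♮ with `M'_k = M_k · side_k / (2⌈θ side_k⌉)` (the top modulus sits in the `U`-even sector by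
  `DiagonalSliceModel.exists_even_top`, so the whole `U`-odd heat trace is `≤ e^{-M_k}` and every odd modulus is `≤ e^{-M_k/(2t)}·λ₀`);
* `oddTorusSwapPairingLiminf_of_diagCold` — the socket D1″ from `DiagCold 𝔪 ∧ Growth r sch` alone, by `core_of_logGap`.

HONEST FRAMING: `DiagCold` is a LETTER (an input a witness constructor must supply: heart-level diagonal cold pressure, equivalently
a two-sided torus-scale gap of `A_k²` with entropy control — it is STRONGER than R2 and than `ExtentFlat ∧ R2` of `Ideas/extent-flatness.md`
up to rates), not derived from the crux's binders.  Nothing about Wilson's model is proved; ⟨27395⟩/⟨27398⟩, D1′, S6i and the summit are OPEN;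
the Yang–Mills mass gap is NOT proved here or anywhere in the tree.  No instance, no notation, `autoImplicit false`.
-/

set_option autoImplicit false

noncomputable section

open MeasureTheory Filter Topology
open Literature.MathematicalPhysics.QuantumLattice Literature.MathematicalPhysics.AQFT
  Literature.MathematicalPhysics.QuantumFieldTheory Literature.Probability.LatticeModels
open Summit.QuantumFields.YangMills.Cruxes.DiagonalMirrorRPR.SignTwistedDiagonalTrace

namespace Summit.QuantumFields.YangMills.Cruxes.WeakCouplingHypercubicLimitRP.ColdPackage

variable {G : Type} [Group G] [TopologicalSpace G] [IsTopologicalGroup G] [CompactSpace G]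
  [MeasurableSpace G] [BorelSpace G] {r : LatticeRep G} {sch : SpeciesScheme (YMSpecies G)}

/-- **Letter `DiagCold`** (diagonal cold pressure, super-logarithmic rate): for some temporal aspect `0 < θ < 1/2` and some
`M_k` with `M_k / log side_k → ∞`, eventually in `k` the normalised even heat trace of the odd root at every `2t ≥ 2θ·side_k` steps is
`≤ 1 + exp(−M_k)` (vacuum dominance of the even closed diagonal geometries over the odd torus's diagonal slice). -/
def DiagCold (𝔪 : DiagonalSliceModel r sch) : Prop :=
  ∃ θ : ℝ, 0 < θ ∧ θ < 1 / 2 ∧ ∃ M : ℕ → ℝ, Tendsto (fun k => M k / Real.log (sch.side k)) atTop atTop ∧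
    ∀ᶠ k in atTop, ∀ t : ℕ, θ * (sch.side k : ℝ) ≤ (t : ℝ) →
      ∑' j, (𝔪.sp k j / 𝔪.top k) ^ (2 * t) + ∑' j, (𝔪.sm k j / 𝔪.top k) ^ (2 * t) ≤ 1 + Real.exp (-(M k))

/-- `DiagCold ⇒ DiagLukewarm` with `C = 2` (eventually `M_k ≥ 0`). -/
theorem diagLukewarm_of_diagCold (𝔪 : DiagonalSliceModel r sch) (h : DiagCold 𝔪) : DiagLukewarm 𝔪 := by
  obtain ⟨θ, hθ0, hθ, M, hM, hcold⟩ := h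
  refine ⟨θ, hθ0, hθ, 2, ?_⟩
  have hM0 : ∀ᶠ k in atTop, 0 ≤ M k := (tendsto_M_atTop sch hM).eventually_ge_atTop 0
  filter_upwards [hcold, hM0] with k hk hMk t ht
  have : Real.exp (-(M k)) ≤ 1 := by
    rw [Real.exp_le_one_iff]; linarith
  linarith [hk t ht]

/-- Summability of the normalised even powers of a square-summable modulus family bounded by `top`. -/
theorem summable_ratio_pow {x : ℕ → ℝ} {top : ℝ} (htop : 0 < top) (h0 : ∀ j, 0 ≤ x j) (hle : ∀ j, x j ≤ top)
    (hs : Summable fun j => x j ^ 2) {t : ℕ} (ht : 1 ≤ t) :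
    Summable fun j => (x j / top) ^ (2 * t) := by
  have hs2 : Summable fun j => (x j / top) ^ 2 := by
    have := hs.div_const (top ^ 2)
    refine this.congr fun j => ?_
    rw [div_pow]
  refine Summable.of_nonneg_of_le (fun j => pow_nonneg (div_nonneg (h0 j) htop.le) _) (fun j => ?_) hs2
  have h1 : x j / top ≤ 1 := (div_le_one htop).2 (hle j)
  have h0' : 0 ≤ x j / top := div_nonneg (h0 j) htop.le
  calc (x j / top) ^ (2 * t) ≤ (x j / top) ^ 2 := pow_le_pow_of_le_one h0' h1 (by omega)
    _ = (x j / top) ^ 2 := rfl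

/-- Root extraction: if `0 ≤ y`, `n ≠ 0` and `y ^ n ≤ exp (-M)` then `y ≤ exp (-(M / n))`. -/
theorem le_exp_of_pow_le {y M : ℝ} {n : ℕ} (_hy : 0 ≤ y) (hn : n ≠ 0) (h : y ^ n ≤ Real.exp (-M)) :
    y ≤ Real.exp (-(M / n)) := by
  by_contra hlt
  push Not at hlt
  have hpow : Real.exp (-(M / n)) ^ n < y ^ n := pow_lt_pow_left₀ hlt (Real.exp_pos _).le hn
  have heq : Real.exp (-(M / n)) ^ n = Real.exp (-M) := by
    rw [← Real.exp_nat_mul]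
    congr 1
    have hn' : (n : ℝ) ≠ 0 := by exact_mod_cast hn
    field_simp
  rw [heq] at hpow
  exact absurd h (not_le.2 hpow)

/-- **`DiagCold ⇒ OddLogGap`** (PROVED): the top modulus is attained in the `U`-even sector (`exists_even_top`), so a cold even trace
leaves at most `e^{-M_k}` for the whole `U`-odd sector at `t = ⌈θ side_k⌉`, hence every odd modulus is `≤ exp(−M_k/(2t))·λ₀(k)`, a
torus-scale gap with super-logarithmic numerator `M'_k = M_k side_k/(2t) ≥ M_k/(4θ)`. -/
theorem oddLogGap_of_diagCold (𝔪 : DiagonalSliceModel r sch) (h : DiagCold 𝔪) : OddLogGap 𝔪 := by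
  obtain ⟨θ, hθ0, hθ, M, hM, hcold⟩ := h
  -- the retyped numerator
  let t : ℕ → ℕ := fun k => ⌈θ * (sch.side k : ℝ)⌉₊
  refine ⟨fun k => M k * (sch.side k : ℝ) / (2 * (t k : ℝ)), ?_, ?_⟩
  · -- super-logarithmic: `M' / log side ≥ (M / log side) / (4θ)` eventually
    have hSinf : Tendsto (fun k => (sch.side k : ℝ)) atTop atTop := tendsto_side_atTop sch
    have hS1 : ∀ᶠ k in atTop, 1 ≤ θ * (sch.side k : ℝ) := (hSinf.const_mul_atTop hθ0).eventually_ge_atTop 1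
    have hMl0 : ∀ᶠ k in atTop, 0 ≤ M k / Real.log (sch.side k) := hM.eventually_ge_atTop 0
    have hθ4 : 0 < 1 / (4 * θ) := by positivity
    refine tendsto_atTop_mono' atTop ?_ (hM.atTop_mul_const hθ4)
    filter_upwards [hS1, hMl0] with k hS1k hMk
    have hSpos : 0 < (sch.side k : ℝ) := by
      have : 0 < θ * (sch.side k : ℝ) := by linarith
      nlinarith
    have htS : θ * (sch.side k : ℝ) ≤ (t k : ℝ) := Nat.le_ceil _
    have htlt : (t k : ℝ) < θ * sch.side k + 1 := Nat.ceil_lt_add_one (by positivity)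
    have htpos : 0 < (t k : ℝ) := by linarith
    have ht2 : (t k : ℝ) ≤ 2 * (θ * sch.side k) := by linarith
    -- `M side/(2t) / log side = (M/log side) · (side/(2t))` and `side/(2t) ≥ 1/(4θ)`
    have hfac : 1 / (4 * θ) ≤ (sch.side k : ℝ) / (2 * (t k : ℝ)) := by
      rw [div_le_div_iff₀ (by positivity) (by positivity)]
      nlinarith
    have hrew : M k * (sch.side k : ℝ) / (2 * (t k : ℝ)) / Real.log (sch.side k)
        = (M k / Real.log (sch.side k)) * ((sch.side k : ℝ) / (2 * (t k : ℝ))) := by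
      ring
    rw [hrew]
    exact mul_le_mul_of_nonneg_left hfac hMk
  · have hSinf : Tendsto (fun k => (sch.side k : ℝ)) atTop atTop := tendsto_side_atTop sch
    have hS1 : ∀ᶠ k in atTop, 1 ≤ θ * (sch.side k : ℝ) := (hSinf.const_mul_atTop hθ0).eventually_ge_atTop 1
    filter_upwards [hcold, hS1] with k hk hS1k j
    have htS : θ * (sch.side k : ℝ) ≤ (t k : ℝ) := Nat.le_ceil _
    have ht1 : 1 ≤ t k := by
      have : (1 : ℝ) ≤ t k := le_trans hS1k htS
      exact_mod_cast this
    have htop := 𝔪.top_pos k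
    have hSpos : 0 < (sch.side k : ℝ) := by
      have : 0 < θ * (sch.side k : ℝ) := by linarith
      nlinarith
    -- the cold trace at `t k`
    have hck := hk (t k) htS
    -- summability of both normalised even power families
    have hsp : Summable fun j => (𝔪.sp k j / 𝔪.top k) ^ (2 * t k) :=
      summable_ratio_pow htop (𝔪.sp_nonneg k) (𝔪.sp_le k) (𝔪.summable_sp k) ht1
    have hsm : Summable fun j => (𝔪.sm k j / 𝔪.top k) ^ (2 * t k) :=
      summable_ratio_pow htop (𝔪.sm_nonneg k) (𝔪.sm_le k) (𝔪.summable_sm k) ht1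
    -- the even trace is ≥ 1 (top attained in the even sector)
    obtain ⟨j₀, hj₀⟩ := 𝔪.exists_even_top k
    have heven1 : 1 ≤ ∑' j, (𝔪.sp k j / 𝔪.top k) ^ (2 * t k) := by
      have h1 : (𝔪.sp k j₀ / 𝔪.top k) ^ (2 * t k) = 1 := by
        rw [hj₀, div_self htop.ne', one_pow]
      rw [← h1]
      exact hsp.le_tsum j₀ (fun i _ => pow_nonneg (div_nonneg (𝔪.sp_nonneg k i) htop.le) _)
    -- hence the odd trace is ≤ e^{-M}
    have hodd : ∑' j, (𝔪.sm k j / 𝔪.top k) ^ (2 * t k) ≤ Real.exp (-(M k)) := by linarith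
    have hj : (𝔪.sm k j / 𝔪.top k) ^ (2 * t k) ≤ Real.exp (-(M k)) :=
      (hsm.le_tsum j (fun i _ => pow_nonneg (div_nonneg (𝔪.sm_nonneg k i) htop.le) _)).trans hodd
    have hroot := le_exp_of_pow_le (div_nonneg (𝔪.sm_nonneg k j) htop.le) (by omega) hj
    -- rewrite `M/(2t) = (M side/(2t))/side`
    have hrew : -(M k / ((2 * t k : ℕ) : ℝ)) = -(M k * (sch.side k : ℝ) / (2 * (t k : ℝ)) / sch.side k) := by
      push_cast
      field_simp
    rw [hrew] at hroot
    calc 𝔪.sm k j = (𝔪.sm k j / 𝔪.top k) * 𝔪.top k := by field_simp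
      _ ≤ Real.exp (-(M k * (sch.side k : ℝ) / (2 * (t k : ℝ)) / sch.side k)) * 𝔪.top k :=
        mul_le_mul_of_nonneg_right hroot htop.le

/-- **The cold package closes the socket (PROVED, via the landed `core_of_logGap`)**: `DiagCold 𝔪 → Growth r sch → OddTorusSwapPairingLiminf r sch`
— no `OddTwistGap`, no `CoarseGap`, no two-shift extraction, no visibility letter. -/
theorem oddTorusSwapPairingLiminf_of_diagCold (𝔪 : DiagonalSliceModel r sch) (hC : DiagCold 𝔪) (hG : Growth r sch) :
    OddTorusSwapPairingLiminf r sch :=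
  core_of_logGap 𝔪 (oddLogGap_of_diagCold 𝔪 hC) (diagLukewarm_of_diagCold 𝔪 hC) hG

/-- `∃ 𝔪` packaging of the cold package. -/
theorem oddTorusSwapPairingLiminf_of_coldLetter (h : ∃ 𝔪 : DiagonalSliceModel r sch, DiagCold 𝔪) (hG : Growth r sch) :
    OddTorusSwapPairingLiminf r sch := by
  obtain ⟨𝔪, h𝔪⟩ := h
  exact oddTorusSwapPairingLiminf_of_diagCold 𝔪 h𝔪 hG

end Summit.QuantumFields.YangMills.Cruxes.WeakCouplingHypercubicLimitRP.ColdPackage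

end
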